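import Mathlib.Analysis.SpecialFunctions.ExpDeriv
import Literature.Analysis.ODE.OneSidedComparison
import HarnessLib

/-!
# Fluid computer blueprint — drain conversion: the SHARP overdamped band

HONEST FRAMING: low prior, high value-of-information experiment on Tao's machine paradigm; NOT a
claim that NS blows up. Elementary planar ODE estimates; nothing is asserted about any fluid
equation or about the threshold gate itself.

## Why

On the transfer window of the threshold gate the damping ratio `γ = g/ω = κã/(rc)` of the
rotor–conduit pair `a' = -ωd`, `d' = ωa - g d` is LARGE and DECREASING (ladder `A = 2`: from
`≈ 9.5` at `c = c_eq/2` down to `≈ 2.4` at `90 %` output; nominal profile, bp3 gen 11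
`code/thgate/profile.py`). The landed band lemma `DrainOverdamped.energy_decay_time_overdamped`
certifies the rate `β/4 = 1/(2γ₁)` per radian on `[2/γ₁, γ₁]`, a factor `4` below the slow rate
`γ₁ - √(γ₁² - 4) ≈ 2/γ₁` of constant damping `γ₁`. This file removes the factor: for a band
`γ₀ω ≤ g ≤ γ₁ω` and parameters `0 < s < 1`, `0 ≤ λ` with the four explicit polynomial side
conditions

  `λ ≤ 2s`, `2s + λ ≤ 2γ₀`, `(sγ - λs)² ≤ (2s - λ)(2γ - 2s - λ)` at `γ = γ₀` and at `γ = γ₁`,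

the Lyapunov function `V = a² + d² - 2s·ad` satisfies `V' ≤ -λ·ω·V + 8Rδ`, whence

* `DampedRotor.energy_decay_time_band` —
  `(1 - s)(a(t)² + d(t)²) ≤ exp(-λΘ(t))·((1 + s)(a(0)² + d(0)²) + 8Rδ·exp(λΘM)·t)`,
  the shape of the landed lemmas (so it plugs into the window bookkeeping verbatim);
* `DampedRotor.lyapunov_alg_band` — the pointwise algebra (the expression is affine in `g`, and a
  nonpositive quadratic form at both ends of the band).

Calibration: `λ = s` is admissible as soon as `2s ≤ γ₀` and `s(γ₁ - s)² + 3s ≤ 2γ₁`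
(`DampedRotor.band_conditions_of_simple`), e.g. `γ₁ = 9.5`: `s = λ = 0.21` (slow rate `0.2129`);
`γ₁ = 3.3`: `s = λ = 0.65` (slow rate `0.675`); the landed `β/4` gives `0.0526` resp. `0.1515`.
[cite: Tao2016AveragedNS, §5.5 (the energy-transfer phase of Thm 5.3)]
-/

noncomputable section

open Set Real

namespace Literature.Analysis.FluidPDE.FluidComputer

open Literature.Analysis.ODE

namespace DampedRotor

/-- A nonpositive binary quadratic form: `A, B ≥ 0` and `C² ≤ AB` give
`-A a² - B d² + 2C·ad ≤ 0`. [folklore] -/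
theorem quadForm_nonpos {A B C a d : ℝ} (hA : 0 ≤ A) (hB : 0 ≤ B) (hC : C ^ 2 ≤ A * B) :
    -A * a ^ 2 - B * d ^ 2 + 2 * C * (a * d) ≤ 0 := by
  rcases eq_or_lt_of_le hA with hA0 | hApos
  · subst hA0
    have hC0 : C = 0 := by nlinarith [sq_nonneg C]
    subst hC0
    nlinarith [sq_nonneg d]
  · have key : A * (A * a ^ 2 + B * d ^ 2 - 2 * C * (a * d)) =
        (A * a - C * d) ^ 2 + (A * B - C ^ 2) * d ^ 2 := by ring
    have h1 : 0 ≤ (A * a - C * d) ^ 2 + (A * B - C ^ 2) * d ^ 2 := by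
      have : 0 ≤ (A * B - C ^ 2) * d ^ 2 := mul_nonneg (by linarith) (sq_nonneg d)
      positivity
    have h2 : 0 ≤ A * a ^ 2 + B * d ^ 2 - 2 * C * (a * d) := by
      by_contra h
      rw [not_le] at h
      have := mul_neg_of_pos_of_neg hApos h
      linarith [key]
    linarith

/-- **The sharp overdamped algebraic step.** For `0 ≤ ω`, a band `γ₀ω ≤ g ≤ γ₁ω` (`γ₀ ≤ γ₁`) and
parameters `s, λ` with `λ ≤ 2s`, `2s + λ ≤ 2γ₀` and the two discriminant conditions
`(sγ - λs)² ≤ (2s - λ)(2γ - 2s - λ)` at `γ = γ₀, γ₁`: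
`-2g·d² + 2sω·d² - 2sω·a² + 2sg·(ad) ≤ -λ·ω·(a² + d² - 2s·ad)`. The left side plus `λωV` is
affine in `g` and equals `ω·Q_γ(a, d)` at `g = γω` with `Q_γ` a nonpositive form at both ends.
[folklore] -/
theorem lyapunov_alg_band {s lam γ₀ γ₁ ω g a d : ℝ} (hω : 0 ≤ ω) (hγ : γ₀ ≤ γ₁)
    (hg₀ : γ₀ * ω ≤ g) (hg₁ : g ≤ γ₁ * ω) (hA : lam ≤ 2 * s) (hB : 2 * s + lam ≤ 2 * γ₀)
    (hD₀ : (s * γ₀ - lam * s) ^ 2 ≤ (2 * s - lam) * (2 * γ₀ - 2 * s - lam))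
    (hD₁ : (s * γ₁ - lam * s) ^ 2 ≤ (2 * s - lam) * (2 * γ₁ - 2 * s - lam)) :
    -2 * g * d ^ 2 + 2 * s * ω * d ^ 2 - 2 * s * ω * a ^ 2 + 2 * s * g * (a * d) ≤
      -(lam * ω * (a ^ 2 + d ^ 2 - 2 * s * (a * d))) := by
  -- the forms at the two ends of the band
  have hQ₀ : -(2 * s - lam) * a ^ 2 - (2 * γ₀ - 2 * s - lam) * d ^ 2 +
      2 * (s * γ₀ - lam * s) * (a * d) ≤ 0 :=
    quadForm_nonpos (by linarith) (by linarith) hD₀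
  have hQ₁ : -(2 * s - lam) * a ^ 2 - (2 * γ₁ - 2 * s - lam) * d ^ 2 +
      2 * (s * γ₁ - lam * s) * (a * d) ≤ 0 :=
    quadForm_nonpos (by linarith) (by linarith) hD₁
  have hQ₀ω := mul_nonpos_of_nonneg_of_nonpos hω hQ₀
  have hQ₁ω := mul_nonpos_of_nonneg_of_nonpos hω hQ₁
  -- affine interpolation in `g`
  have hid₀ : -2 * g * d ^ 2 + 2 * s * ω * d ^ 2 - 2 * s * ω * a ^ 2 + 2 * s * g * (a * d) +
      lam * ω * (a ^ 2 + d ^ 2 - 2 * s * (a * d)) =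
      ω * (-(2 * s - lam) * a ^ 2 - (2 * γ₀ - 2 * s - lam) * d ^ 2 +
        2 * (s * γ₀ - lam * s) * (a * d)) + (g - γ₀ * ω) * (-2 * d ^ 2 + 2 * s * (a * d)) := by
    ring
  have hid₁ : -2 * g * d ^ 2 + 2 * s * ω * d ^ 2 - 2 * s * ω * a ^ 2 + 2 * s * g * (a * d) +
      lam * ω * (a ^ 2 + d ^ 2 - 2 * s * (a * d)) =
      ω * (-(2 * s - lam) * a ^ 2 - (2 * γ₁ - 2 * s - lam) * d ^ 2 +
        2 * (s * γ₁ - lam * s) * (a * d)) + (g - γ₁ * ω) * (-2 * d ^ 2 + 2 * s * (a * d)) := by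
    ring
  have he₀ : 0 ≤ g - γ₀ * ω := by linarith
  have he₁ : g - γ₁ * ω ≤ 0 := by linarith
  rcases le_or_gt (-2 * d ^ 2 + 2 * s * (a * d)) 0 with hE | hE
  · have h1 : (g - γ₀ * ω) * (-2 * d ^ 2 + 2 * s * (a * d)) ≤ 0 :=
      mul_nonpos_of_nonneg_of_nonpos he₀ hE
    linarith [hid₀, h1, hQ₀ω]
  · have h1 : (g - γ₁ * ω) * (-2 * d ^ 2 + 2 * s * (a * d)) ≤ 0 :=
      mul_nonpos_of_nonpos_of_nonneg he₁ hE.le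
    linarith [hid₁, h1, hQ₁ω]

/-- **The simple admissible choice `λ = s`.** If `0 ≤ s ≤ 1`, `2s ≤ γ₀ ≤ γ₁` and
`s(γ₁ - s)² + 3s ≤ 2γ₁`, then `(s, λ := s)` satisfies the four side conditions of
`lyapunov_alg_band`. (The cubic `γ ↦ 2γ - 3s - s(γ - s)²` is concave, nonnegative at `γ = 2s`
since `s ≤ 1`, and at `γ = γ₁` by hypothesis, hence on `[2s, γ₁] ∋ γ₀`.) [folklore] -/
theorem band_conditions_of_simple {s γ₀ γ₁ : ℝ} (hs0 : 0 ≤ s) (hs1 : s ≤ 1) (hγ₀ : 2 * s ≤ γ₀)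
    (hγ : γ₀ ≤ γ₁) (hγ₁ : s * (γ₁ - s) ^ 2 + 3 * s ≤ 2 * γ₁) :
    s ≤ 2 * s ∧ 2 * s + s ≤ 2 * γ₀ ∧
    (s * γ₀ - s * s) ^ 2 ≤ (2 * s - s) * (2 * γ₀ - 2 * s - s) ∧
    (s * γ₁ - s * s) ^ 2 ≤ (2 * s - s) * (2 * γ₁ - 2 * s - s) := by
  refine ⟨by linarith, by linarith, ?_, ?_⟩
  · have f2s : 0 ≤ 2 * (2 * s) - 3 * s - s * (2 * s - s) ^ 2 := by
      have e : 2 * (2 * s) - 3 * s - s * (2 * s - s) ^ 2 = s * (1 - s) * (1 + s) := by ring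
      rw [e]
      have : 0 ≤ 1 - s := by linarith
      positivity
    have fγ₁ : 0 ≤ 2 * γ₁ - 3 * s - s * (γ₁ - s) ^ 2 := by linarith
    have hconc : 0 ≤ 2 * γ₀ - 3 * s - s * (γ₀ - s) ^ 2 := by
      rcases eq_or_lt_of_le (le_trans hγ₀ hγ) with heq | hlt
      · have : γ₀ = γ₁ := le_antisymm hγ (heq ▸ hγ₀)
        rw [this]; exact fγ₁
      · have hden : 0 < γ₁ - 2 * s := by linarith
        set θ := (γ₀ - 2 * s) / (γ₁ - 2 * s) with hθ
        have hθ0 : 0 ≤ θ := div_nonneg (by linarith) hden.le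
        have hθ1 : θ ≤ 1 := (div_le_one hden).2 (by linarith)
        have hγ₀eq : γ₀ = (1 - θ) * (2 * s) + θ * γ₁ := by
          have hne : γ₁ - 2 * s ≠ 0 := hden.ne'
          rw [hθ]; field_simp; ring
        have hsq : (1 - θ) * (2 * s - s) ^ 2 + θ * (γ₁ - s) ^ 2 - (γ₀ - s) ^ 2 =
            θ * (1 - θ) * (γ₁ - 2 * s) ^ 2 := by
          rw [hγ₀eq]; ring
        have hsq0 : 0 ≤ θ * (1 - θ) * (γ₁ - 2 * s) ^ 2 := by
          have : 0 ≤ 1 - θ := by linarith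
          positivity
        have hlin : 2 * γ₀ - 3 * s =
            (1 - θ) * (2 * (2 * s) - 3 * s) + θ * (2 * γ₁ - 3 * s) := by
          rw [hγ₀eq]; ring
        have h1 : s * (γ₀ - s) ^ 2 ≤ s * ((1 - θ) * (2 * s - s) ^ 2 + θ * (γ₁ - s) ^ 2) :=
          mul_le_mul_of_nonneg_left (by linarith [hsq, hsq0]) hs0
        have h2 : 0 ≤ (1 - θ) * (2 * (2 * s) - 3 * s - s * (2 * s - s) ^ 2) :=
          mul_nonneg (by linarith) f2s
        have h3 : 0 ≤ θ * (2 * γ₁ - 3 * s - s * (γ₁ - s) ^ 2) := mul_nonneg hθ0 fγ₁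
        nlinarith [h1, h2, h3, hlin]
    have e1 : (s * γ₀ - s * s) ^ 2 = s * (s * (γ₀ - s) ^ 2) := by ring
    have e2 : (2 * s - s) * (2 * γ₀ - 2 * s - s) = s * (2 * γ₀ - 3 * s) := by ring
    rw [e1, e2]
    exact mul_le_mul_of_nonneg_left (by linarith) hs0
  · have e1 : (s * γ₁ - s * s) ^ 2 = s * (s * (γ₁ - s) ^ 2) := by ring
    have e2 : (2 * s - s) * (2 * γ₁ - 2 * s - s) = s * (2 * γ₁ - 3 * s) := by ring
    rw [e1, e2]
    exact mul_le_mul_of_nonneg_left (by linarith) hs0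

variable {a d a' d' ω g Θ : ℝ → ℝ} {s lam γ₀ γ₁ R δ ΘM T : ℝ}

/-- **Sharp overdamped pair-energy decay in time, weighted by the angle.** See the module
docstring: on a band `γ₀ω ≤ g ≤ γ₁ω` with `(s, λ)` admissible (`0 < s < 1`, `0 ≤ λ ≤ 2s`,
`2s + λ ≤ 2γ₀`, the two discriminant conditions),
`(1 - s)(a(t)² + d(t)²) ≤ exp(-λΘ(t))·((1 + s)(a(0)² + d(0)²) + 8Rδ·exp(λΘM)·t)`.
[folklore] -/
theorem energy_decay_time_band (hac : ContinuousOn a (Icc 0 T))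
    (hdc : ContinuousOn d (Icc 0 T))
    (ha' : ∀ u ∈ Ico 0 T, HasDerivWithinAt a (a' u) (Ici u) u)
    (hd' : ∀ u ∈ Ico 0 T, HasDerivWithinAt d (d' u) (Ici u) u)
    (hΘc : ContinuousOn Θ (Icc 0 T)) (hΘ0 : Θ 0 = 0)
    (hΘ' : ∀ u ∈ Ico 0 T, HasDerivWithinAt Θ (ω u) (Ici u) u) (hΘM : ∀ u ∈ Icc 0 T, Θ u ≤ ΘM)
    (hω : ∀ u ∈ Ico 0 T, 0 ≤ ω u) (hs0 : 0 < s) (hs1 : s < 1) (hγ : γ₀ ≤ γ₁)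
    (hlam0 : 0 ≤ lam) (hA : lam ≤ 2 * s) (hB : 2 * s + lam ≤ 2 * γ₀)
    (hD₀ : (s * γ₀ - lam * s) ^ 2 ≤ (2 * s - lam) * (2 * γ₀ - 2 * s - lam))
    (hD₁ : (s * γ₁ - lam * s) ^ 2 ≤ (2 * s - lam) * (2 * γ₁ - 2 * s - lam))
    (hg : ∀ u ∈ Ico 0 T, γ₀ * ω u ≤ g u ∧ g u ≤ γ₁ * ω u) (hR : 0 ≤ R) (hδ : 0 ≤ δ)
    (hab : ∀ u ∈ Ico 0 T, |a u| ≤ R ∧ |d u| ≤ R)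
    (hp : ∀ u ∈ Ico 0 T, |a' u + ω u * d u| ≤ δ)
    (hq : ∀ u ∈ Ico 0 T, |d' u - (ω u * a u - g u * d u)| ≤ δ) :
    ∀ t ∈ Icc 0 T, (1 - s) * (a t ^ 2 + d t ^ 2) ≤
      exp (-lam * Θ t) * ((1 + s) * (a 0 ^ 2 + d 0 ^ 2) + 8 * R * δ * exp (lam * ΘM) * t) := by
  intro t ht
  have hm : 0 < 1 - s := by linarith
  have hRδ : 0 ≤ R * δ := mul_nonneg hR hδ
  -- Lyapunov function `V = a² + d² - 2s ad`
  set V : ℝ → ℝ := fun u => a u * a u + d u * d u - 2 * s * (a u * d u) with hV_def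
  set V' : ℝ → ℝ := fun u => (a' u * a u + a u * a' u) + (d' u * d u + d u * d' u) -
    2 * s * (a' u * d u + a u * d' u) with hV'_def
  have hVc : ContinuousOn V (Icc 0 T) :=
    ((hac.mul hac).add (hdc.mul hdc)).sub (continuousOn_const.mul (hac.mul hdc))
  have hVd : ∀ u ∈ Ico 0 T, HasDerivWithinAt V (V' u) (Ici u) u := fun u hu =>
    (((ha' u hu).mul (ha' u hu)).add ((hd' u hu).mul (hd' u hu))).sub
      (((ha' u hu).mul (hd' u hu)).const_mul (2 * s))
  have hsand : ∀ u, (1 - s) * (a u ^ 2 + d u ^ 2) ≤ V u ∧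
      V u ≤ (1 + s) * (a u ^ 2 + d u ^ 2) := by
    intro u
    have h1 : a u * d u ≤ (a u ^ 2 + d u ^ 2) / 2 := by nlinarith [sq_nonneg (a u - d u)]
    have h2 : -(a u * d u) ≤ (a u ^ 2 + d u ^ 2) / 2 := by nlinarith [sq_nonneg (a u + d u)]
    have h3 := mul_le_mul_of_nonneg_left h1 hs0.le
    have h4 := mul_le_mul_of_nonneg_left h2 hs0.le
    have hV : V u = a u ^ 2 + d u ^ 2 - 2 * s * (a u * d u) := by simp only [hV_def]; ring
    constructor <;> linarith [hV, h3, h4]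
  -- `V' + lam ω V ≤ 8Rδ`
  have hineq : ∀ u ∈ Ico 0 T, V' u + lam * ω u * V u ≤ 8 * R * δ := by
    intro u hu
    obtain ⟨hgs0, hgs1⟩ := hg u hu
    obtain ⟨haR, hdR⟩ := hab u hu
    have hωs := hω u hu
    set p := a' u + ω u * d u with hp_def
    set q := d' u - (ω u * a u - g u * d u) with hq_def
    have hpδ : |p| ≤ δ := hp u hu
    have hqδ : |q| ≤ δ := hq u hu
    have ea : a' u = -(ω u * d u) + p := by simp only [hp_def]; ring
    have ed : d' u = ω u * a u - g u * d u + q := by simp only [hq_def]; ring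
    have halg := lyapunov_alg_band (a := a u) (d := d u) hωs hγ hgs0 hgs1 hA hB hD₀ hD₁
    have hf1 : a u * p ≤ R * δ := by
      have h := le_abs_self (a u * p); rw [abs_mul] at h
      exact h.trans (mul_le_mul haR hpδ (abs_nonneg p) hR)
    have hf2 : d u * q ≤ R * δ := by
      have h := le_abs_self (d u * q); rw [abs_mul] at h
      exact h.trans (mul_le_mul hdR hqδ (abs_nonneg q) hR)
    have hf3 : -(p * d u) ≤ R * δ := by
      have h := neg_le_abs (p * d u); rw [abs_mul] at h
      have h2 : |p| * |d u| ≤ δ * R := mul_le_mul hpδ hdR (abs_nonneg _) hδ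
      linarith
    have hf4 : -(a u * q) ≤ R * δ := by
      have h := neg_le_abs (a u * q); rw [abs_mul] at h
      exact h.trans (mul_le_mul haR hqδ (abs_nonneg q) hR)
    have hf3' := mul_le_mul_of_nonneg_left hf3 (by linarith : (0:ℝ) ≤ 2 * s)
    have hf4' := mul_le_mul_of_nonneg_left hf4 (by linarith : (0:ℝ) ≤ 2 * s)
    have hγRδ : 2 * s * (R * δ) ≤ 2 * (R * δ) :=
      mul_le_mul_of_nonneg_right (by linarith : 2 * s ≤ 2) hRδ
    have hVs : V u = a u ^ 2 + d u ^ 2 - 2 * s * (a u * d u) := by simp only [hV_def]; ring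
    have hid : V' u + lam * ω u * V u =
        (-2 * g u * d u ^ 2 + 2 * s * ω u * d u ^ 2 - 2 * s * ω u * a u ^ 2 +
          2 * s * g u * (a u * d u)) +
        (2 * (a u * p) + 2 * (d u * q) + 2 * s * (-(p * d u)) + 2 * s * (-(a u * q))) +
        lam * ω u * V u := by
      simp only [hV'_def, hVs, ea, ed]; ring
    rw [hid]
    have hmain : -2 * g u * d u ^ 2 + 2 * s * ω u * d u ^ 2 - 2 * s * ω u * a u ^ 2 +
        2 * s * g u * (a u * d u) ≤ -(lam * ω u * V u) := by
      rw [hVs]; exact halg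
    linarith [hmain, hf1, hf2, hf3', hf4', hγRδ, hRδ]
  -- `W = exp(lam Θ) V` has `W' ≤ 8Rδ exp(lam ΘM)`
  have hE : ∀ u ∈ Ico 0 T, HasDerivWithinAt (fun x => exp (lam * Θ x))
      (exp (lam * Θ u) * (lam * ω u)) (Ici u) u :=
    fun u hu => ((hΘ' u hu).const_mul lam).exp
  have hWc : ContinuousOn (fun u => exp (lam * Θ u) * V u) (Icc 0 T) :=
    ((continuousOn_const.mul hΘc).rexp).mul hVc
  have hWd : ∀ u ∈ Ico 0 T, HasDerivWithinAt (fun x => exp (lam * Θ x) * V x)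
      (exp (lam * Θ u) * (lam * ω u) * V u + exp (lam * Θ u) * V' u) (Ici u) u :=
    fun u hu => (hE u hu).mul (hVd u hu)
  set M := 8 * R * δ * exp (lam * ΘM) with hM_def
  have hbd : ∀ u ∈ Ico 0 T,
      exp (lam * Θ u) * (lam * ω u) * V u + exp (lam * Θ u) * V' u ≤ M := by
    intro u hu
    have hes : 0 < exp (lam * Θ u) := exp_pos _
    have h1 : exp (lam * Θ u) * (lam * ω u) * V u + exp (lam * Θ u) * V' u =
        exp (lam * Θ u) * (V' u + lam * ω u * V u) := by ring
    rw [h1]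
    have h2 : exp (lam * Θ u) * (V' u + lam * ω u * V u) ≤ exp (lam * Θ u) * (8 * R * δ) :=
      mul_le_mul_of_nonneg_left (hineq u hu) hes.le
    have h3 : exp (lam * Θ u) ≤ exp (lam * ΘM) :=
      exp_le_exp.2 (mul_le_mul_of_nonneg_left (hΘM u (Ico_subset_Icc_self hu)) hlam0)
    have h4 := mul_le_mul_of_nonneg_right h3 (by positivity : (0:ℝ) ≤ 8 * R * δ)
    simp only [hM_def]; linarith
  have hmain := sub_le_mul_of_deriv_right_le hWc hWd hbd t ht
  simp only [hΘ0, mul_zero, exp_zero, one_mul, sub_zero] at hmain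
  -- unwind
  have het : 0 < exp (lam * Θ t) := exp_pos _
  have hexp_neg : exp (-lam * Θ t) = (exp (lam * Θ t))⁻¹ := by
    rw [← exp_neg]; congr 1; ring
  have hM0 : 0 ≤ M := by positivity
  have hVt : V t ≤ (exp (lam * Θ t))⁻¹ * (V 0 + M * t) := by
    rw [le_inv_mul_iff₀ het]; linarith
  have hV0 := (hsand 0).2
  have hlo := (hsand t).1
  have hi0 : 0 ≤ (exp (lam * Θ t))⁻¹ := inv_nonneg.2 het.le
  have hm' := mul_le_mul_of_nonneg_left
    (by linarith [hV0] : V 0 + M * t ≤ (1 + s) * (a 0 ^ 2 + d 0 ^ 2) + M * t) hi0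
  rw [hexp_neg]
  simp only [hM_def] at hm' hVt
  linarith [hlo, hVt, hm']

/-- Calibration instance (ladder `A = 2`, first sub-window after `c = c_eq/2`: band top
`γ₁ = 9.5`): `s = λ = 21/100` is admissible on `[21/50, 19/2]`; the landed overdamped rate there
is `β/4 = 1/19`. [folklore] -/
example : (21 / 100 : ℝ) * (19 / 2 - 21 / 100) ^ 2 + 3 * (21 / 100) ≤ 2 * (19 / 2) := by
  norm_num

end DampedRotor

end Literature.Analysis.FluidPDE.FluidComputer

end
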